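import Literature.Analysis.Asymptotics.SlowlyVaryingUniform
import Mathlib.MeasureTheory.Function.LocallyIntegrable
import HarnessLib

/-!
# Potter's bounds and Karamata's theorem (direct half) for integrals of regularly varying functions

Topic `Literature/Analysis/Asymptotics`; companion (theorems only) to `SlowlyVaryingUniform.lean`
(the uniform convergence theorem) and `KaramataTauberianLaplace.lean` (`IsSlowlyVarying`).
Throughout `L` is measurable, eventually positive and slowly varying at infinity.

* `IsSlowlyVarying.exists_potter_bounds` — **Potter's theorem** (Bingham–Goldie–Teugels
  Theorem 1.5.6 (ii), with `A = e^δ`): for every `δ > 0` there is `X > 0` with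
  `L(y)/L(x) < e^δ (x/y)^δ` and `L(x)/L(y) < e^δ (x/y)^δ` for `X ≤ y ≤ x` (Feller VIII.8 (8.7),
  `x^{-ε} < L(x) < x^{ε}`, is the one-variable case, `SlowlyVaryingUniform.lean`). Proof: the
  additive uniform convergence theorem on `[0,1]`, chained along unit steps
  (`KaramataIntegral.abs_sub_lt_of_unit_steps`), gives `|log L(x) - log L(y)| < (log(x/y) + 1)δ`.
* `IsSlowlyVarying.exists_forall_integrableOn_Ioc` — BGT Lemma 1.3.2: `L` is bounded, hence
  integrable, on every finite interval far enough to the right.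
* `IsSlowlyVarying.tendsto_rpow_mul_atTop` — BGT Prop. 1.3.6 (v): `x^ρ L(x) → ∞` for `ρ > 0`.
* `IsSlowlyVarying.tendsto_setIntegral_rpow_mul_div` — **Karamata's theorem, direct half**
  (BGT Proposition 1.5.8 with `σ = ρ - 1 > -1`; Feller VIII.9 Theorem 1 (9.5)): for `0 < ρ`,
  `0 < X` and `L` integrable on each `(X, x]`,
  `(∫_X^x t^{ρ-1} L(t) dt)/(x^ρ L(x)) → 1/ρ`. Proof as in BGT: on `[θx, x]` the uniform convergence
  theorem, on `[Y, θx]` the Potter bound with exponent `ρ/2` (contribution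
  `≤ (2e^{ρ/2}/ρ) θ^{ρ/2} x^ρ L(x)`), the head `[X, Y]` is constant while `x^ρ L(x) → ∞`.
* `IsSlowlyVarying.tendsto_setIntegral_div_of_tendsto_div` — the same for an integrand `f` with
  `f(t)/(t^{ρ-1} L(t)) → c`: `(∫_X^x f)/(x^ρ L(x)) → c/ρ` (the form behind Feller XIII.5's remark
  "(5.18) implies (5.16) even if `u` is not monotone"; it removes the hypothesis "`L` eventually
  non-decreasing, index `0`" of `SlowlyVaryingIntegral.lean`).

-- TODO(general form): the converse half of Karamata's theorem (BGT Theorem 1.6.1), the case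
-- `σ = -1` (BGT Prop. 1.5.9a) and `σ < -1` (Prop. 1.5.10, integrals to `∞`) are not included.

## References

* N. H. Bingham, C. M. Goldie, J. L. Teugels, *Regular Variation*, Encyclopedia Math. Appl. 27,
  CUP 1987, Theorem 1.5.6 (Potter's theorem), Lemma 1.3.2, Prop. 1.3.6 (v), Prop. 1.5.8
  (Karamata's theorem, direct half). [cite: BinghamGoldieTeugels1987]
* W. Feller, *An Introduction to Probability Theory and Its Applications* II, 2nd ed., Wiley 1971,
  VIII.8 Lemma 2 (8.7), VIII.9 Theorem 1 (9.5). [cite: Feller1971]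
-/

noncomputable section

open MeasureTheory Filter Set
open scoped Topology

namespace Literature.Analysis.Asymptotics

variable {L : ℝ → ℝ}

namespace KaramataIntegral

/-- Chaining unit steps between two points: if `|g(s+v) - g(s)| < δ` for all `s ≥ T`, `v ∈ [0,1]`,
then `|g(s) - g(s')| < (s - s' + 1) δ` for `T ≤ s' ≤ s`. [folklore] -/
private theorem abs_sub_lt_of_unit_steps {g : ℝ → ℝ} {T δ : ℝ}
    (hT : ∀ s ≥ T, ∀ v ∈ Icc (0 : ℝ) 1, |g (s + v) - g s| < δ) {s' s : ℝ} (hs' : T ≤ s')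
    (hs : s' ≤ s) : |g s - g s'| < (s - s' + 1) * δ := by
  have key : ∀ k : ℕ, ∀ r ∈ Icc (s' + k) (s' + k + 1), |g r - g s'| < (k + 1) * δ := by
    intro k
    induction k with
    | zero =>
      intro r hr
      simp only [Nat.cast_zero, add_zero, zero_add, one_mul] at hr ⊢
      have := hT s' hs' (r - s') ⟨by linarith [hr.1], by linarith [hr.2]⟩
      rwa [show s' + (r - s') = r by ring] at this
    | succ k ih =>
      intro r hr
      push_cast at hr ⊢
      have hk : (0 : ℝ) ≤ k := Nat.cast_nonneg k
      have h1 := ih (r - 1) ⟨by linarith [hr.1], by linarith [hr.2]⟩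
      have h2 := hT (r - 1) (by linarith [hr.1]) 1 ⟨zero_le_one, le_rfl⟩
      rw [show r - 1 + 1 = r by ring] at h2
      calc |g r - g s'| ≤ |g r - g (r - 1)| + |g (r - 1) - g s'| := abs_sub_le _ _ _
        _ < δ + (k + 1) * δ := add_lt_add h2 h1
        _ = (k + 1 + 1) * δ := by ring
  obtain ⟨k, hk1, hk2⟩ : ∃ k : ℕ, (k : ℝ) ≤ s - s' ∧ s - s' < k + 1 :=
    ⟨⌊s - s'⌋₊, Nat.floor_le (by linarith), Nat.lt_floor_add_one _⟩
  have hδ : 0 < δ := by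
    have := hT s' hs' 0 ⟨le_rfl, zero_le_one⟩
    exact lt_of_le_of_lt (abs_nonneg _) this
  calc |g s - g s'| < (k + 1) * δ := key k s ⟨by linarith, by linarith⟩
    _ ≤ (s - s' + 1) * δ := mul_le_mul_of_nonneg_right (by linarith) hδ.le

end KaramataIntegral

open KaramataIntegral SlowlyVaryingUniform

/-- **Potter's bounds** (Bingham–Goldie–Teugels Theorem 1.5.6 (ii) with `A = e^δ`; the
one-variable case is Feller VIII.8 (8.7)): if `L` is measurable, eventually positive and slowly
varying at infinity, then for every `δ > 0` there is `X > 0` such that, whenever `X ≤ y ≤ x`,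
`L > 0` at `x, y` and `L(y)/L(x) < e^δ (x/y)^δ`, `L(x)/L(y) < e^δ (x/y)^δ`. Proof: the additive
uniform convergence theorem on `[0,1]` chained along unit steps gives
`|log L(x) - log L(y)| < (log(x/y) + 1) δ`. [cite: BinghamGoldieTeugels1987, Theorem 1.5.6 (ii)] -/
theorem IsSlowlyVarying.exists_potter_bounds (hL : IsSlowlyVarying L) (hmeas : Measurable L)
    (hLpos : ∀ᶠ x in atTop, 0 < L x) {δ : ℝ} (hδ : 0 < δ) :
    ∃ X > 0, ∀ x y : ℝ, X ≤ y → y ≤ x →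
      0 < L y ∧ 0 < L x ∧ L y / L x < Real.exp δ * (x / y) ^ δ ∧
        L x / L y < Real.exp δ * (x / y) ^ δ := by
  set g : ℝ → ℝ := fun t => Real.log (L (Real.exp t)) with hg_def
  have hg : Measurable g := Real.measurable_log.comp (hmeas.comp Real.measurable_exp)
  have hadd : ∀ u : ℝ, Tendsto (fun t => g (t + u) - g t) atTop (𝓝 0) :=
    fun u => hL.tendsto_log_exp_add_sub hLpos u
  obtain ⟨T, hT⟩ := eventually_atTop.mp (tendsto_sub_uniformlyOn hg hadd 0 1 hδ)
  obtain ⟨X₁, hX₁⟩ := eventually_atTop.mp hLpos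
  refine ⟨max (Real.exp T) (max X₁ 1),
    lt_of_lt_of_le one_pos (le_trans (le_max_right _ _) (le_max_right _ _)), fun x y hy hyx => ?_⟩
  simp only [max_le_iff] at hy
  obtain ⟨hyT, hyX, hy1⟩ := hy
  have hy0 : 0 < y := by linarith
  have hx0 : 0 < x := by linarith
  have hLy : 0 < L y := hX₁ y hyX
  have hLx : 0 < L x := hX₁ x (by linarith)
  have hs' : T ≤ Real.log y := by
    rw [← Real.log_exp T]; exact Real.log_le_log (Real.exp_pos T) hyT
  have hss : Real.log y ≤ Real.log x := Real.log_le_log hy0 hyx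
  have key := abs_sub_lt_of_unit_steps hT hs' hss
  have e1 : g (Real.log x) = Real.log (L x) := by simp only [hg_def]; rw [Real.exp_log hx0]
  have e2 : g (Real.log y) = Real.log (L y) := by simp only [hg_def]; rw [Real.exp_log hy0]
  rw [e1, e2] at key
  have hxy : 0 < x / y := div_pos hx0 hy0
  have hbound : ∀ z : ℝ, |z| < (Real.log x - Real.log y + 1) * δ →
      Real.exp z < Real.exp δ * (x / y) ^ δ := by
    intro z hz
    rw [Real.rpow_def_of_pos hxy, ← Real.exp_add, Real.exp_lt_exp, Real.log_div hx0.ne' hy0.ne']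
    have := (abs_lt.mp hz).2
    linarith
  refine ⟨hLy, hLx, ?_, ?_⟩
  · rw [← Real.exp_log (div_pos hLy hLx), Real.log_div hLy.ne' hLx.ne']
    refine hbound _ ?_
    rw [abs_sub_comm]; exact key
  · rw [← Real.exp_log (div_pos hLx hLy), Real.log_div hLx.ne' hLy.ne']
    exact hbound _ key

/-- A measurable, eventually positive, slowly varying `L` is bounded — hence integrable — on
every finite interval far enough to the right (Bingham–Goldie–Teugels Lemma 1.3.2, a corollary
of the uniform convergence theorem). [cite: BinghamGoldieTeugels1987, Lemma 1.3.2] -/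
theorem IsSlowlyVarying.exists_forall_integrableOn_Ioc (hL : IsSlowlyVarying L)
    (hmeas : Measurable L) (hLpos : ∀ᶠ x in atTop, 0 < L x) :
    ∃ X > 0, ∀ a b : ℝ, X ≤ a → IntegrableOn L (Ioc a b) := by
  obtain ⟨X, hX0, hX⟩ := hL.exists_potter_bounds hmeas hLpos one_pos
  refine ⟨X, hX0, fun a b ha => ?_⟩
  rcases le_or_gt b a with hba | hab
  · rw [Ioc_eq_empty (not_lt.mpr hba)]; exact integrableOn_empty
  have ha0 : 0 < a := lt_of_lt_of_le hX0 ha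
  refine Measure.integrableOn_of_bounded (M := Real.exp 1 * (b / a) * L b)
    (by rw [Real.volume_Ioc]; exact ENNReal.ofReal_ne_top) hmeas.aestronglyMeasurable ?_
  rw [ae_restrict_iff' measurableSet_Ioc]
  refine Eventually.of_forall fun t ht => ?_
  obtain ⟨hLt, hLb, h1, -⟩ := hX b t (ha.trans ht.1.le) ht.2
  rw [Real.norm_eq_abs, abs_of_pos hLt]
  have h2 : (b / t) ^ (1 : ℝ) ≤ b / a := by
    rw [Real.rpow_one]; exact div_le_div_of_nonneg_left (by linarith) ha0 ht.1.le
  have h3 : L t / L b < Real.exp 1 * (b / a) :=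
    lt_of_lt_of_le h1 (mul_le_mul_of_nonneg_left h2 (Real.exp_pos 1).le)
  rw [div_lt_iff₀ hLb] at h3
  exact h3.le

/-- `x^ρ L(x) → ∞` for `ρ > 0` and `L` measurable, eventually positive, slowly varying
(Bingham–Goldie–Teugels Prop. 1.3.6 (v)), from the Potter bound with exponent `ρ/2`.
[cite: BinghamGoldieTeugels1987, Proposition 1.3.6 (v)] -/
theorem IsSlowlyVarying.tendsto_rpow_mul_atTop (hL : IsSlowlyVarying L) (hmeas : Measurable L)
    (hLpos : ∀ᶠ x in atTop, 0 < L x) {ρ : ℝ} (hρ : 0 < ρ) :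
    Tendsto (fun x : ℝ => x ^ ρ * L x) atTop atTop := by
  have hδ : 0 < ρ / 2 := by positivity
  obtain ⟨Y, hY0, hP⟩ := hL.exists_potter_bounds hmeas hLpos hδ
  have hLY : 0 < L Y := (hP Y Y le_rfl le_rfl).1
  have hc : 0 < L Y * Real.exp (-(ρ / 2)) * Y ^ (ρ / 2) := by positivity
  have h1 : Tendsto (fun x : ℝ => L Y * Real.exp (-(ρ / 2)) * Y ^ (ρ / 2) * x ^ (ρ - ρ / 2))
      atTop atTop :=
    (tendsto_rpow_atTop (by linarith : 0 < ρ - ρ / 2)).const_mul_atTop hc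
  refine tendsto_atTop_mono' atTop ?_ h1
  filter_upwards [eventually_ge_atTop Y] with x hx
  obtain ⟨-, hLx, h2, -⟩ := hP x Y le_rfl hx
  have hx0 : 0 < x := lt_of_lt_of_le hY0 hx
  have hYδ : 0 < Y ^ (ρ / 2) := Real.rpow_pos_of_pos hY0 _
  have hxδ : 0 < x ^ (ρ / 2) := Real.rpow_pos_of_pos hx0 _
  have h3 : L Y * Y ^ (ρ / 2) ≤ Real.exp (ρ / 2) * x ^ (ρ / 2) * L x := by
    rw [div_lt_iff₀ hLx, Real.div_rpow hx0.le hY0.le] at h2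
    have := mul_le_mul_of_nonneg_right h2.le hYδ.le
    calc L Y * Y ^ (ρ / 2)
        ≤ Real.exp (ρ / 2) * (x ^ (ρ / 2) / Y ^ (ρ / 2)) * L x * Y ^ (ρ / 2) := this
      _ = Real.exp (ρ / 2) * x ^ (ρ / 2) * L x := by field_simp
  calc L Y * Real.exp (-(ρ / 2)) * Y ^ (ρ / 2) * x ^ (ρ - ρ / 2)
      = (L Y * Y ^ (ρ / 2)) * (Real.exp (-(ρ / 2)) * x ^ (ρ - ρ / 2)) := by ring
    _ ≤ (Real.exp (ρ / 2) * x ^ (ρ / 2) * L x) * (Real.exp (-(ρ / 2)) * x ^ (ρ - ρ / 2)) :=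
        mul_le_mul_of_nonneg_right h3 (by positivity)
    _ = x ^ ρ * L x := by
        rw [Real.rpow_sub hx0, Real.exp_neg]
        have : Real.exp (ρ / 2) ≠ 0 := (Real.exp_pos _).ne'
        field_simp

/-- **Karamata's theorem, direct half** (Bingham–Goldie–Teugels Proposition 1.5.8 with
`σ = ρ - 1 > -1`; Feller VIII.9 Theorem 1, (9.5) with `p = ρ - 1`): if `L` is measurable,
eventually positive and slowly varying at infinity, `0 < ρ`, `0 < X` and `L` is integrable on
each `(X, x]`, then `(∫_X^x t^{ρ-1} L(t) dt)/(x^ρ L(x)) → 1/ρ` as `x → ∞`. Proof: on `[θx, x]` the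
uniform convergence theorem gives `L(t) = L(x)(1 + o(1))`; on `[Y, θx]` the Potter bound with
exponent `ρ/2` gives a contribution `≤ (2e^{ρ/2}/ρ) θ^{ρ/2} x^ρ L(x)`; the head `[X, Y]` is constant
while `x^ρ L(x) → ∞`. [cite: BinghamGoldieTeugels1987, Proposition 1.5.8] -/
theorem IsSlowlyVarying.tendsto_setIntegral_rpow_mul_div (hL : IsSlowlyVarying L)
    (hmeas : Measurable L) (hLpos : ∀ᶠ x in atTop, 0 < L x) {ρ X : ℝ} (hρ : 0 < ρ) (hX : 0 < X)
    (hint : ∀ x, IntegrableOn L (Ioc X x)) :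
    Tendsto (fun x : ℝ => (∫ t in Ioc X x, t ^ (ρ - 1) * L t) / (x ^ ρ * L x)) atTop
      (𝓝 (1 / ρ)) := by
  -- Potter bounds with exponent `δ = ρ/2` beyond `Y ≥ X`
  set δ : ℝ := ρ / 2 with hδ_def
  have hδ : 0 < δ := by positivity
  obtain ⟨Y₁, hY₁0, hP⟩ := hL.exists_potter_bounds hmeas hLpos hδ
  set Y : ℝ := max X Y₁ with hY_def
  have hXY : X ≤ Y := le_max_left _ _
  have hY₁Y : Y₁ ≤ Y := le_max_right _ _
  have hY0 : 0 < Y := lt_of_lt_of_le hX hXY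
  have hLpos' : ∀ t, Y ≤ t → 0 < L t := fun t ht => (hP t t (hY₁Y.trans ht) le_rfl).1
  -- integrability of `t^σ L(t)` on `(a, b]` for `X ≤ a`, and of `t^σ` for `0 < a`
  have hintP : ∀ σ a b : ℝ, X ≤ a → IntegrableOn (fun t => t ^ σ * L t) (Ioc a b) := by
    intro σ a b ha
    refine IntegrableOn.continuousOn_mul_of_subset ?_
      ((hint b).mono_set (Ioc_subset_Ioc_left ha)) isCompact_Icc measurableSet_Ioc
      Ioc_subset_Icc_self
    exact fun t ht => (Real.continuousAt_rpow_const t σ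
      (Or.inl (lt_of_lt_of_le hX (ha.trans ht.1)).ne')).continuousWithinAt
  have hpowInt : ∀ σ a b : ℝ, 0 < a → IntegrableOn (fun t : ℝ => t ^ σ) (Ioc a b) := by
    intro σ a b ha
    refine (ContinuousOn.integrableOn_Icc fun t ht => ?_).mono_set Ioc_subset_Icc_self
    exact (Real.continuousAt_rpow_const t σ (Or.inl (ha.trans_le ht.1).ne')).continuousWithinAt
  have hgrow := hL.tendsto_rpow_mul_atTop hmeas hLpos hρ
  rw [Metric.tendsto_nhds]
  intro ε hε
  have hε4 : 0 < ε / 4 := by positivity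
  -- choose `θ ∈ (0,1)` with `θ^ρ/ρ < ε/4` and `(e^δ/δ) θ^δ < ε/4`
  obtain ⟨θ, ⟨hθ0, hθ1⟩, hθa, hθb⟩ : ∃ θ : ℝ, θ ∈ Ioo (0 : ℝ) 1 ∧ θ ^ ρ / ρ < ε / 4 ∧
      Real.exp δ / δ * θ ^ δ < ε / 4 := by
    have h1 : Tendsto (fun θ : ℝ => θ ^ ρ / ρ) (𝓝[>] 0) (𝓝 0) := by
      have := ((Real.continuousAt_rpow_const 0 ρ (Or.inr hρ.le)).tendsto.mono_left
        (nhdsWithin_le_nhds (s := Ioi (0 : ℝ)))).div_const ρ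
      rwa [Real.zero_rpow hρ.ne', zero_div] at this
    have h2 : Tendsto (fun θ : ℝ => Real.exp δ / δ * θ ^ δ) (𝓝[>] 0) (𝓝 0) := by
      have := ((Real.continuousAt_rpow_const 0 δ (Or.inr hδ.le)).tendsto.mono_left
        (nhdsWithin_le_nhds (s := Ioi (0 : ℝ)))).const_mul (Real.exp δ / δ)
      rwa [Real.zero_rpow hδ.ne', mul_zero] at this
    have h0 : ∀ᶠ θ in 𝓝[>] (0 : ℝ), θ ∈ Ioo (0 : ℝ) 1 := Ioo_mem_nhdsGT one_pos
    obtain ⟨θ, hθ⟩ := (h0.and ((h1.eventually (gt_mem_nhds hε4)).and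
      (h2.eventually (gt_mem_nhds hε4)))).exists
    exact ⟨θ, hθ.1, hθ.2.1, hθ.2.2⟩
  -- UCT on `[θ, 1]` with tolerance `η = ε ρ / 4`
  set η : ℝ := ε * ρ / 4 with hη_def
  have hη : 0 < η := by positivity
  have hU := Metric.tendstoUniformlyOn_iff.mp (hL.tendstoUniformlyOn_div hmeas hLpos hθ0 (b := 1))
    η hη
  -- the head integral is constant
  set H : ℝ := ∫ t in Ioc X Y, t ^ (ρ - 1) * L t with hH_def
  have hhead : ∀ᶠ x : ℝ in atTop, |H| / (x ^ ρ * L x) < ε / 4 := by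
    filter_upwards [hgrow.eventually (eventually_gt_atTop (max 0 (|H| / (ε / 4))))] with x hx
    have hD : 0 < x ^ ρ * L x := lt_of_le_of_lt (le_max_left _ _) hx
    rw [div_lt_iff₀ hD]
    have := lt_of_le_of_lt (le_max_right _ _) hx
    rw [div_lt_iff₀ hε4] at this
    linarith
  filter_upwards [hhead, hU, eventually_ge_atTop (Y / θ), eventually_ge_atTop Y]
    with x hxH hxU hxθ hxY
  have hx0 : 0 < x := lt_of_lt_of_le hY0 hxY
  have hθx : Y ≤ θ * x := by rwa [div_le_iff₀ hθ0, mul_comm] at hxθ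
  have hθxx : θ * x ≤ x := by nlinarith
  have hθx0 : 0 < θ * x := by positivity
  have hLx : 0 < L x := hLpos' x hxY
  have hxρ : 0 < x ^ ρ := Real.rpow_pos_of_pos hx0 ρ
  have hD : 0 < x ^ ρ * L x := mul_pos hxρ hLx
  -- split the integral: head + middle + tail
  have e_split : (∫ t in Ioc X x, t ^ (ρ - 1) * L t) =
      H + (∫ t in Ioc Y (θ * x), t ^ (ρ - 1) * L t) +
        ∫ t in Ioc (θ * x) x, t ^ (ρ - 1) * L t := by
    rw [hH_def, ← setIntegral_union (Ioc_disjoint_Ioc_of_le le_rfl) measurableSet_Ioc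
        (hintP _ X Y le_rfl) (hintP _ Y (θ * x) hXY), Ioc_union_Ioc_eq_Ioc hXY hθx,
      ← setIntegral_union (Ioc_disjoint_Ioc_of_le le_rfl) measurableSet_Ioc
        (hintP _ X (θ * x) le_rfl) (hintP _ (θ * x) x (hXY.trans hθx)),
      Ioc_union_Ioc_eq_Ioc (hXY.trans hθx) hθxx]
  -- middle block: Potter bound
  have hM0 : 0 ≤ ∫ t in Ioc Y (θ * x), t ^ (ρ - 1) * L t :=
    setIntegral_nonneg measurableSet_Ioc fun t ht =>
      mul_nonneg (Real.rpow_nonneg (hY0.le.trans ht.1.le) _) (hLpos' t ht.1.le).le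
  have hM : (∫ t in Ioc Y (θ * x), t ^ (ρ - 1) * L t) ≤
      Real.exp δ / δ * θ ^ δ * (x ^ ρ * L x) := by
    have hpt : ∀ t ∈ Ioc Y (θ * x),
        t ^ (ρ - 1) * L t ≤ Real.exp δ * L x * x ^ δ * t ^ (δ - 1) := by
      intro t ht
      have ht0 : 0 < t := hY0.trans ht.1
      obtain ⟨hLt, -, h1, -⟩ := hP x t (hY₁Y.trans ht.1.le) (ht.2.trans hθxx)
      rw [div_lt_iff₀ hLx, Real.div_rpow hx0.le ht0.le] at h1
      have htρ : 0 < t ^ (ρ - 1) := Real.rpow_pos_of_pos ht0 _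
      have htδ : 0 < t ^ δ := Real.rpow_pos_of_pos ht0 _
      have e : t ^ (ρ - 1) * (Real.exp δ * (x ^ δ / t ^ δ) * L x) =
          Real.exp δ * L x * x ^ δ * t ^ (δ - 1) := by
        have : t ^ (δ - 1) = t ^ (ρ - 1) / t ^ δ := by
          rw [← Real.rpow_sub ht0]; congr 1; rw [hδ_def]; ring
        rw [this]
        field_simp
      calc t ^ (ρ - 1) * L t ≤ t ^ (ρ - 1) * (Real.exp δ * (x ^ δ / t ^ δ) * L x) :=
            mul_le_mul_of_nonneg_left h1.le htρ.le
        _ = _ := e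
    have hIcmp : IntegrableOn (fun t => Real.exp δ * L x * x ^ δ * t ^ (δ - 1))
        (Ioc Y (θ * x)) := (hpowInt (δ - 1) Y (θ * x) hY0).const_mul _
    have hc0 : 0 ≤ Real.exp δ * L x * x ^ δ :=
      (mul_pos (mul_pos (Real.exp_pos δ) hLx) (Real.rpow_pos_of_pos hx0 δ)).le
    calc (∫ t in Ioc Y (θ * x), t ^ (ρ - 1) * L t)
        ≤ ∫ t in Ioc Y (θ * x), Real.exp δ * L x * x ^ δ * t ^ (δ - 1) :=
          setIntegral_mono_on (hintP _ Y _ hXY) hIcmp measurableSet_Ioc hpt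
      _ = Real.exp δ * L x * x ^ δ * (((θ * x) ^ δ - Y ^ δ) / δ) := by
          rw [integral_const_mul, ← intervalIntegral.integral_of_le hθx,
            integral_rpow (Or.inl (by linarith)), show δ - 1 + 1 = δ by ring]
      _ ≤ Real.exp δ * L x * x ^ δ * ((θ * x) ^ δ / δ) := by
          refine mul_le_mul_of_nonneg_left (div_le_div_of_nonneg_right ?_ hδ.le) hc0
          linarith [Real.rpow_nonneg hY0.le δ]
      _ = Real.exp δ / δ * θ ^ δ * (x ^ ρ * L x) := by
          rw [Real.mul_rpow hθ0.le hx0.le, show x ^ ρ = x ^ (δ + δ) by rw [hδ_def]; ring_nf,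
            Real.rpow_add hx0]
          field_simp
  -- tail block: uniform convergence theorem
  set I : ℝ := ∫ t in Ioc (θ * x) x, t ^ (ρ - 1) with hI_def
  have hI : I = x ^ ρ * (1 - θ ^ ρ) / ρ := by
    rw [hI_def, ← intervalIntegral.integral_of_le hθxx, integral_rpow (Or.inl (by linarith)),
      show ρ - 1 + 1 = ρ by ring, Real.mul_rpow hθ0.le hx0.le]
    ring
  have hI0 : 0 ≤ I := by
    rw [hI_def]
    exact setIntegral_nonneg measurableSet_Ioc fun t ht =>
      Real.rpow_nonneg (hθx0.le.trans ht.1.le) _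
  have hT : |(∫ t in Ioc (θ * x) x, t ^ (ρ - 1) * L t) - L x * I| ≤ η * L x * I := by
    have hpt : ∀ t ∈ Ioc (θ * x) x, |L t - L x| ≤ η * L x := by
      intro t ht
      have hc : t / x ∈ Icc θ 1 :=
        ⟨by rw [le_div_iff₀ hx0]; exact ht.1.le, by rw [div_le_one hx0]; exact ht.2⟩
      have h1 := hxU (t / x) hc
      have e : t / x * x = t := by field_simp
      simp only [e] at h1
      rw [dist_comm, Real.dist_eq] at h1
      have e2 : |L t - L x| = |L t / L x - 1| * L x := by
        rw [← abs_of_pos hLx, ← abs_mul, abs_of_pos hLx]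
        congr 1
        field_simp
      rw [e2]
      exact mul_le_mul_of_nonneg_right h1.le hLx.le
    have hint1 : IntegrableOn (fun t => t ^ (ρ - 1) * L t) (Ioc (θ * x) x) :=
      hintP _ _ _ (hXY.trans hθx)
    have hint2 : IntegrableOn (fun t => t ^ (ρ - 1) * L x) (Ioc (θ * x) x) :=
      (hpowInt _ _ _ hθx0).mul_const _
    have hint3 : IntegrableOn (fun t => η * L x * t ^ (ρ - 1)) (Ioc (θ * x) x) :=
      (hpowInt _ _ _ hθx0).const_mul _
    have eLI : L x * I = ∫ t in Ioc (θ * x) x, t ^ (ρ - 1) * L x := by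
      rw [integral_mul_const, hI_def, mul_comm]
    rw [eLI, ← integral_sub hint1 hint2]
    calc |∫ t in Ioc (θ * x) x, (t ^ (ρ - 1) * L t - t ^ (ρ - 1) * L x)|
        ≤ ∫ t in Ioc (θ * x) x, |t ^ (ρ - 1) * L t - t ^ (ρ - 1) * L x| := by
          have := norm_integral_le_integral_norm (μ := volume.restrict (Ioc (θ * x) x))
            (fun t => t ^ (ρ - 1) * L t - t ^ (ρ - 1) * L x)
          simpa only [Real.norm_eq_abs] using this
      _ ≤ ∫ t in Ioc (θ * x) x, η * L x * t ^ (ρ - 1) := by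
          refine setIntegral_mono_on (hint1.sub hint2).abs hint3 measurableSet_Ioc
            fun t ht => ?_
          have ht0 : 0 < t := hθx0.trans ht.1
          rw [← mul_sub, abs_mul, abs_of_pos (Real.rpow_pos_of_pos ht0 _)]
          calc t ^ (ρ - 1) * |L t - L x| ≤ t ^ (ρ - 1) * (η * L x) :=
                mul_le_mul_of_nonneg_left (hpt t ht) (Real.rpow_nonneg ht0.le _)
            _ = η * L x * t ^ (ρ - 1) := by ring
      _ = η * L x * I := by rw [integral_const_mul, hI_def]
  -- assemble
  rw [Real.dist_eq, e_split]
  have key : (H + (∫ t in Ioc Y (θ * x), t ^ (ρ - 1) * L t) +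
        ∫ t in Ioc (θ * x) x, t ^ (ρ - 1) * L t) / (x ^ ρ * L x) - 1 / ρ =
      H / (x ^ ρ * L x) + (∫ t in Ioc Y (θ * x), t ^ (ρ - 1) * L t) / (x ^ ρ * L x) +
        ((∫ t in Ioc (θ * x) x, t ^ (ρ - 1) * L t) - L x * I) / (x ^ ρ * L x) - θ ^ ρ / ρ := by
    rw [hI]
    field_simp
    ring
  rw [key]
  have h1 : |H / (x ^ ρ * L x)| < ε / 4 := by rw [abs_div, abs_of_pos hD]; exact hxH
  have h2 : |(∫ t in Ioc Y (θ * x), t ^ (ρ - 1) * L t) / (x ^ ρ * L x)| < ε / 4 := by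
    rw [abs_div, abs_of_pos hD, abs_of_nonneg hM0, div_lt_iff₀ hD]
    exact lt_of_le_of_lt hM (mul_lt_mul_of_pos_right hθb hD)
  have h3 : |((∫ t in Ioc (θ * x) x, t ^ (ρ - 1) * L t) - L x * I) / (x ^ ρ * L x)| ≤ ε / 4 := by
    rw [abs_div, abs_of_pos hD, div_le_iff₀ hD]
    have hI' : I ≤ x ^ ρ / ρ := by
      rw [hI]
      refine div_le_div_of_nonneg_right ?_ hρ.le
      nlinarith [Real.rpow_nonneg hθ0.le ρ, hxρ]
    calc |(∫ t in Ioc (θ * x) x, t ^ (ρ - 1) * L t) - L x * I| ≤ η * L x * I := hT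
      _ ≤ η * L x * (x ^ ρ / ρ) := mul_le_mul_of_nonneg_left hI' (mul_pos hη hLx).le
      _ = ε / 4 * (x ^ ρ * L x) := by rw [hη_def]; field_simp
  have h4 : |θ ^ ρ / ρ| < ε / 4 := by
    rw [abs_of_nonneg (div_nonneg (Real.rpow_nonneg hθ0.le ρ) hρ.le)]; exact hθa
  have tri : ∀ a b c d : ℝ, |a + b + c - d| ≤ |a| + |b| + |c| + |d| := by
    intro a b c d
    calc |a + b + c - d| ≤ |a + b + c| + |d| := abs_sub _ _
      _ ≤ |a + b| + |c| + |d| := by gcongr; exact abs_add_le _ _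
      _ ≤ |a| + |b| + |c| + |d| := by gcongr; exact abs_add_le _ _
  linarith [tri (H / (x ^ ρ * L x)) ((∫ t in Ioc Y (θ * x), t ^ (ρ - 1) * L t) / (x ^ ρ * L x))
    (((∫ t in Ioc (θ * x) x, t ^ (ρ - 1) * L t) - L x * I) / (x ^ ρ * L x)) (θ ^ ρ / ρ)]

/-- **Karamata's theorem, direct half, for an integrand asymptotic to a regularly varying
function** (the form used for densities; Feller VIII.9 Theorem 1 (9.5) with `Z = u`, `p = 0`,
`γ = ρ - 1`, and XIII.5: "(5.18) implies (5.16) even if `u` is not monotone"): if `L` is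
measurable, eventually positive and slowly varying, `0 < ρ`, `0 < X`, `L` and `f` are integrable
on each `(X, x]`, and `f(t)/(t^{ρ-1} L(t)) → c` as `t → ∞`, then `(∫_X^x f)/(x^ρ L(x)) → c/ρ`.
[cite: BinghamGoldieTeugels1987, Proposition 1.5.8] -/
theorem IsSlowlyVarying.tendsto_setIntegral_div_of_tendsto_div (hL : IsSlowlyVarying L)
    (hmeas : Measurable L) (hLpos : ∀ᶠ x in atTop, 0 < L x) {ρ X c : ℝ} {f : ℝ → ℝ}
    (hρ : 0 < ρ) (hX : 0 < X) (hint : ∀ x, IntegrableOn L (Ioc X x))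
    (hf : ∀ x, IntegrableOn f (Ioc X x))
    (hfL : Tendsto (fun t => f t / (t ^ (ρ - 1) * L t)) atTop (𝓝 c)) :
    Tendsto (fun x : ℝ => (∫ t in Ioc X x, f t) / (x ^ ρ * L x)) atTop (𝓝 (c / ρ)) := by
  have hK := hL.tendsto_setIntegral_rpow_mul_div hmeas hLpos hρ hX hint
  have hgrow := hL.tendsto_rpow_mul_atTop hmeas hLpos hρ
  have hintP : ∀ a b : ℝ, X ≤ a → IntegrableOn (fun t => t ^ (ρ - 1) * L t) (Ioc a b) := by
    intro a b ha
    refine IntegrableOn.continuousOn_mul_of_subset ?_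
      ((hint b).mono_set (Ioc_subset_Ioc_left ha)) isCompact_Icc measurableSet_Ioc
      Ioc_subset_Icc_self
    exact fun t ht => (Real.continuousAt_rpow_const t (ρ - 1)
      (Or.inl (lt_of_lt_of_le hX (ha.trans ht.1)).ne')).continuousWithinAt
  rw [Metric.tendsto_nhds]
  intro ε hε
  have hε3 : 0 < ε / 3 := by positivity
  -- tolerances `ε'` (for `f` against `c t^{ρ-1} L`) and `τ` (for Karamata's theorem)
  set ε' : ℝ := ε / (3 * (1 / ρ + 2)) with hε'_def
  have hρinv : 0 < 1 / ρ := by positivity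
  have hε' : 0 < ε' := by positivity
  have hε'b : ε' * (1 / ρ + 1) < ε / 3 := by
    have : ε' * (1 / ρ + 2) = ε / 3 := by
      rw [hε'_def]
      field_simp
    nlinarith
  set τ : ℝ := min 1 (ε / (3 * (|c| + 1))) with hτ_def
  have hτ : 0 < τ := lt_min one_pos (by positivity)
  have hτ1 : τ ≤ 1 := min_le_left _ _
  have hτc : |c| * τ ≤ ε / 3 := by
    have h1 : τ ≤ ε / (3 * (|c| + 1)) := min_le_right _ _
    have h2 : |c| * τ ≤ (|c| + 1) * τ := by nlinarith [abs_nonneg c]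
    have h3 : (|c| + 1) * (ε / (3 * (|c| + 1))) = ε / 3 := by
      field_simp
    nlinarith [abs_nonneg c, mul_le_mul_of_nonneg_left h1 (by positivity : (0 : ℝ) ≤ |c| + 1)]
  -- `Z ≥ X` beyond which `|f/(t^{ρ-1} L) - c| < ε'` and `L > 0`
  obtain ⟨Z₁, hZ₁⟩ := eventually_atTop.mp (((Metric.tendsto_nhds.mp hfL) ε' hε').and hLpos)
  set Z : ℝ := max X Z₁ with hZ_def
  have hXZ : X ≤ Z := le_max_left _ _
  have hZ : ∀ t, Z ≤ t → dist (f t / (t ^ (ρ - 1) * L t)) c < ε' ∧ 0 < L t :=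
    fun t ht => hZ₁ t ((le_max_right _ _).trans ht)
  have hZ0 : 0 < Z := lt_of_lt_of_le hX hXZ
  -- the constant heads
  set A : ℝ := ∫ t in Ioc X Z, f t with hA_def
  set B : ℝ := ∫ t in Ioc X Z, t ^ (ρ - 1) * L t with hB_def
  have hev1 : ∀ᶠ x : ℝ in atTop, (|A| + |c| * |B| + ε' * |B|) / (x ^ ρ * L x) < ε / 3 := by
    filter_upwards [hgrow.eventually (eventually_gt_atTop
      (max 0 ((|A| + |c| * |B| + ε' * |B|) / (ε / 3))))] with x hx
    have hD : 0 < x ^ ρ * L x := lt_of_le_of_lt (le_max_left _ _) hx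
    have := lt_of_le_of_lt (le_max_right _ _) hx
    rw [div_lt_iff₀ hε3] at this
    rw [div_lt_iff₀ hD]
    linarith
  have hev2 := (Metric.tendsto_nhds.mp hK) τ hτ
  filter_upwards [hev1, hev2, eventually_ge_atTop Z] with x hx1 hx2 hxZ
  have hx0 : 0 < x := hZ0.trans_le hxZ
  have hLx : 0 < L x := (hZ x hxZ).2
  have hD : 0 < x ^ ρ * L x := mul_pos (Real.rpow_pos_of_pos hx0 ρ) hLx
  -- split at `Z`
  have ef : (∫ t in Ioc X x, f t) = A + ∫ t in Ioc Z x, f t := by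
    rw [hA_def, ← setIntegral_union (Ioc_disjoint_Ioc_of_le le_rfl) measurableSet_Ioc
      (hf Z) ((hf x).mono_set (Ioc_subset_Ioc_left hXZ)), Ioc_union_Ioc_eq_Ioc hXZ hxZ]
  have eK : (∫ t in Ioc X x, t ^ (ρ - 1) * L t) = B + ∫ t in Ioc Z x, t ^ (ρ - 1) * L t := by
    rw [hB_def, ← setIntegral_union (Ioc_disjoint_Ioc_of_le le_rfl) measurableSet_Ioc
      (hintP X Z le_rfl) (hintP Z x hXZ), Ioc_union_Ioc_eq_Ioc hXZ hxZ]
  -- on `(Z, x]`: `|f - c t^{ρ-1} L| ≤ ε' t^{ρ-1} L`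
  have hpt : ∀ t ∈ Ioc Z x, |f t - c * (t ^ (ρ - 1) * L t)| ≤ ε' * (t ^ (ρ - 1) * L t) := by
    intro t ht
    obtain ⟨h1, hLt⟩ := hZ t ht.1.le
    have ht0 : 0 < t := hZ0.trans ht.1
    have hw : 0 < t ^ (ρ - 1) * L t := mul_pos (Real.rpow_pos_of_pos ht0 _) hLt
    rw [Real.dist_eq] at h1
    have e : f t - c * (t ^ (ρ - 1) * L t) =
        (f t / (t ^ (ρ - 1) * L t) - c) * (t ^ (ρ - 1) * L t) := by
      field_simp
    rw [e, abs_mul, abs_of_pos hw]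
    exact mul_le_mul_of_nonneg_right h1.le hw.le
  have hKZ0 : 0 ≤ ∫ t in Ioc Z x, t ^ (ρ - 1) * L t :=
    setIntegral_nonneg measurableSet_Ioc fun t ht =>
      (mul_pos (Real.rpow_pos_of_pos (hZ0.trans ht.1) _) (hZ t ht.1.le).2).le
  have hmid : |(∫ t in Ioc Z x, f t) - c * ∫ t in Ioc Z x, t ^ (ρ - 1) * L t| ≤
      ε' * ∫ t in Ioc Z x, t ^ (ρ - 1) * L t := by
    have hi1 : IntegrableOn f (Ioc Z x) := (hf x).mono_set (Ioc_subset_Ioc_left hXZ)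
    have hi2 : IntegrableOn (fun t => c * (t ^ (ρ - 1) * L t)) (Ioc Z x) :=
      (hintP Z x hXZ).const_mul c
    have hi3 : IntegrableOn (fun t => ε' * (t ^ (ρ - 1) * L t)) (Ioc Z x) :=
      (hintP Z x hXZ).const_mul ε'
    rw [← integral_const_mul, ← integral_sub hi1 hi2, ← integral_const_mul]
    calc |∫ t in Ioc Z x, (f t - c * (t ^ (ρ - 1) * L t))|
        ≤ ∫ t in Ioc Z x, |f t - c * (t ^ (ρ - 1) * L t)| := by
          have := norm_integral_le_integral_norm (μ := volume.restrict (Ioc Z x))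
            (fun t => f t - c * (t ^ (ρ - 1) * L t))
          simpa only [Real.norm_eq_abs] using this
      _ ≤ ∫ t in Ioc Z x, ε' * (t ^ (ρ - 1) * L t) :=
          setIntegral_mono_on (hi1.sub hi2).abs hi3 measurableSet_Ioc hpt
  -- assemble
  rw [Real.dist_eq, ef]
  have hx2' : |(B + ∫ t in Ioc Z x, t ^ (ρ - 1) * L t) / (x ^ ρ * L x) - 1 / ρ| < τ := by
    rw [← eK]; rwa [Real.dist_eq] at hx2
  have key : (A + ∫ t in Ioc Z x, f t) / (x ^ ρ * L x) - c / ρ =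
      (A - c * B) / (x ^ ρ * L x) +
        ((∫ t in Ioc Z x, f t) - c * ∫ t in Ioc Z x, t ^ (ρ - 1) * L t) / (x ^ ρ * L x) +
        c * ((B + ∫ t in Ioc Z x, t ^ (ρ - 1) * L t) / (x ^ ρ * L x) - 1 / ρ) := by
    field_simp
    ring
  rw [key]
  -- the three terms
  have hKZD : (∫ t in Ioc Z x, t ^ (ρ - 1) * L t) / (x ^ ρ * L x) ≤
      1 / ρ + 1 + |B| / (x ^ ρ * L x) := by
    have h1 := (abs_lt.mp hx2').2
    have h2 : (∫ t in Ioc Z x, t ^ (ρ - 1) * L t) / (x ^ ρ * L x) =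
        (B + ∫ t in Ioc Z x, t ^ (ρ - 1) * L t) / (x ^ ρ * L x) - B / (x ^ ρ * L x) := by
      field_simp
      ring
    rw [h2]
    have h3 : -(B / (x ^ ρ * L x)) ≤ |B| / (x ^ ρ * L x) := by
      rw [← neg_div]; exact div_le_div_of_nonneg_right (neg_le_abs B) hD.le
    linarith
  have t1 : |(A - c * B) / (x ^ ρ * L x)| ≤ (|A| + |c| * |B|) / (x ^ ρ * L x) := by
    rw [abs_div, abs_of_pos hD]
    refine div_le_div_of_nonneg_right ?_ hD.le
    calc |A - c * B| ≤ |A| + |c * B| := abs_sub _ _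
      _ = |A| + |c| * |B| := by rw [abs_mul]
  have t2 : |((∫ t in Ioc Z x, f t) - c * ∫ t in Ioc Z x, t ^ (ρ - 1) * L t) / (x ^ ρ * L x)|
      ≤ ε' * (1 / ρ + 1) + ε' * |B| / (x ^ ρ * L x) := by
    rw [abs_div, abs_of_pos hD, div_le_iff₀ hD]
    calc |(∫ t in Ioc Z x, f t) - c * ∫ t in Ioc Z x, t ^ (ρ - 1) * L t|
        ≤ ε' * ∫ t in Ioc Z x, t ^ (ρ - 1) * L t := hmid
      _ = ε' * ((∫ t in Ioc Z x, t ^ (ρ - 1) * L t) / (x ^ ρ * L x)) * (x ^ ρ * L x) := by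
          field_simp
      _ ≤ ε' * (1 / ρ + 1 + |B| / (x ^ ρ * L x)) * (x ^ ρ * L x) := by
          gcongr
      _ = (ε' * (1 / ρ + 1) + ε' * |B| / (x ^ ρ * L x)) * (x ^ ρ * L x) := by
          field_simp
  have t3 : |c * ((B + ∫ t in Ioc Z x, t ^ (ρ - 1) * L t) / (x ^ ρ * L x) - 1 / ρ)| ≤ ε / 3 := by
    rw [abs_mul]
    exact (mul_le_mul_of_nonneg_left hx2'.le (abs_nonneg c)).trans hτc
  have hsum : (|A| + |c| * |B|) / (x ^ ρ * L x) + ε' * |B| / (x ^ ρ * L x) =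
      (|A| + |c| * |B| + ε' * |B|) / (x ^ ρ * L x) := by
    field_simp
  calc |(A - c * B) / (x ^ ρ * L x) +
        ((∫ t in Ioc Z x, f t) - c * ∫ t in Ioc Z x, t ^ (ρ - 1) * L t) / (x ^ ρ * L x) +
        c * ((B + ∫ t in Ioc Z x, t ^ (ρ - 1) * L t) / (x ^ ρ * L x) - 1 / ρ)|
      ≤ |(A - c * B) / (x ^ ρ * L x)| +
        |((∫ t in Ioc Z x, f t) - c * ∫ t in Ioc Z x, t ^ (ρ - 1) * L t) / (x ^ ρ * L x)| +
        |c * ((B + ∫ t in Ioc Z x, t ^ (ρ - 1) * L t) / (x ^ ρ * L x) - 1 / ρ)| := by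
        refine (abs_add_le _ _).trans ?_
        gcongr
        exact abs_add_le _ _
    _ < ε := by linarith [t1, t2, t3, hsum, hx1, hε'b]

end Literature.Analysis.Asymptotics
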